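import Literature.NumberTheory.Automorphic.Paramodular.ParamodularForms

/-!
# Sanity lemmas for the paramodular Hecke vocabulary (pub-paramod REVIEW-RUNBOOK, cards
# `IsHeckeEigenAt`, `heckeT`, `heckeT1`, `heckeT1Reps`, `bp2`)

Review evidence only (ops-runbook sanity registry `registry/pub-paramod.json`); no new definitions.

* the Siegel upper half space `ℍ₂` is inhabited (`iI ∈ ℍ₂`), so the `∀ Z ∈ ℍ₂` clauses of
  `IsHeckeEigenAt` / `IsParamodularForm` are not vacuous;
* `heckeT k p` and `heckeT1 k p` are linear (zero, additive, homogeneous) — they are finite sums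
  of slash operators;
* holds-instance: the zero function is a `T(p)`/`T₁(p²)`-eigenfunction for EVERY pair of numbers
  `(a, a₁)` (so eigenvalues are determined only for `f ≢ 0` on `ℍ₂`, cf.
  `HasSpinorEulerFactorAt.unique`);
* fails-instance: in weight `0` the constant function `1` has `1|₀T(2) = 15 · 2⁻³ ≠ 0 · 1`, so
  `IsHeckeEigenAt 0 2 1 0 a₁` is false — the predicate is not trivially true;
* the printed representative list of `T₁(p²)` has the printed length `p(1+p)(1+p²)`
  ([BrumerEtAl2019, (4.2.14)], companion of the tree's `length_heckeTReps`);
* `bp2` in weight `2` is `p a₁ + (1+p²)/p` (the honest `p⁻¹` of [BrumerEtAl2019, (4.2.16)]);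
* the spinor Hecke polynomial has constant term `1`.
-/

open scoped Matrix

namespace Summit.Langlands.Paramodular.Runbook

open Literature.NumberTheory.Automorphic Literature.NumberTheory.Automorphic.Paramodular

/-! ## `ℍ₂` is inhabited -/

/-- The point `i·1₂` (`Z = diag(i, i)`) lies in the Siegel upper half space of degree `2`:
it is symmetric and its imaginary part is the identity, which is positive definite. -/
theorem I_smul_one_mem_siegelUpperHalfSpace :
    Complex.I • (1 : Matrix (Fin 2) (Fin 2) ℂ) ∈ siegelUpperHalfSpace 2 := by
  rw [mem_siegelUpperHalfSpace_iff]
  refine ⟨?_, ?_⟩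
  · simp [Matrix.IsSymm]
  · have h : (Complex.I • (1 : Matrix (Fin 2) (Fin 2) ℂ)).map Complex.im = 1 := by
      ext i j
      fin_cases i <;> fin_cases j <;> simp
    rw [h]
    exact Matrix.PosDef.one

/-- Hence the Siegel upper half space of degree `2` is nonempty. -/
theorem siegelUpperHalfSpace_two_nonempty : (siegelUpperHalfSpace 2).Nonempty :=
  ⟨_, I_smul_one_mem_siegelUpperHalfSpace⟩

/-! ## Linearity of `T(p)` and `T₁(p²)` -/

/-- `0|_k T(p) = 0`. -/
theorem heckeT_zero (k p : ℕ) : heckeT k p 0 = 0 := by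
  funext Z
  simp [heckeT, slash]

/-- `0|_k T₁(p²) = 0`. -/
theorem heckeT1_zero (k p : ℕ) : heckeT1 k p 0 = 0 := by
  funext Z
  simp [heckeT1, slash]

/-- `T(p)` is additive in `f`. -/
theorem heckeT_add (k p : ℕ) (f g : Matrix (Fin 2) (Fin 2) ℂ → ℂ) :
    heckeT k p (f + g) = heckeT k p f + heckeT k p g := by
  funext Z
  simp only [heckeT, slash_add, Pi.add_apply, List.sum_map_add]

/-- `T(p)` commutes with scalars. -/
theorem heckeT_smul (k p : ℕ) (c : ℂ) (f : Matrix (Fin 2) (Fin 2) ℂ → ℂ) :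
    heckeT k p (c • f) = c • heckeT k p f := by
  funext Z
  simp only [heckeT, slash_smul, Pi.smul_apply, smul_eq_mul, List.sum_map_mul_left]

/-- `T₁(p²)` is additive in `f`. -/
theorem heckeT1_add (k p : ℕ) (f g : Matrix (Fin 2) (Fin 2) ℂ → ℂ) :
    heckeT1 k p (f + g) = heckeT1 k p f + heckeT1 k p g := by
  funext Z
  simp only [heckeT1, slash_add, Pi.add_apply, List.sum_map_add]

/-- `T₁(p²)` commutes with scalars. -/
theorem heckeT1_smul (k p : ℕ) (c : ℂ) (f : Matrix (Fin 2) (Fin 2) ℂ → ℂ) :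
    heckeT1 k p (c • f) = c • heckeT1 k p f := by
  funext Z
  simp only [heckeT1, slash_smul, Pi.smul_apply, smul_eq_mul, List.sum_map_mul_left]

/-! ## `IsHeckeEigenAt`: a holds-instance and a fails-instance -/

/-- Holds-instance (degenerate): the zero function is an eigenfunction of `T(p)` and `T₁(p²)` with
ANY prescribed eigenvalues `a`, `a₁` — which is why uniqueness of the spinor Euler factor
(`HasSpinorEulerFactorAt.unique`) needs `f ≢ 0` on `ℍ₂`. -/
theorem isHeckeEigenAt_zero (k p : ℕ) (a a₁ : ℂ) : IsHeckeEigenAt k p 0 a a₁ := by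
  refine ⟨fun Z _ => ?_, fun Z _ => ?_⟩
  · simp [heckeT_zero]
  · simp [heckeT1_zero]

/-- In weight `0` the slash of a constant function is the constant `μ⁻³ · c`
(`μ^{2·0-3} · det(CZ+D)^0 · c`). -/
theorem slash_weight_zero_const (μ : ℚ) (M : Matrix (Fin 2 ⊕ Fin 2) (Fin 2 ⊕ Fin 2) ℚ) (c : ℂ)
    (Z : Matrix (Fin 2) (Fin 2) ℂ) :
    slash 0 μ M (fun _ => c) Z = (μ : ℂ) ^ (-3 : ℤ) * c := by
  simp [slash]

/-- In weight `0`, `c|₀T(p)` is the constant `(1+p)(1+p²) · p⁻³ · c` (one term `p⁻³ c` per printed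
representative, `length_heckeTReps`). -/
theorem heckeT_weight_zero_const (p : ℕ) (c : ℂ) (Z : Matrix (Fin 2) (Fin 2) ℂ) :
    heckeT 0 p (fun _ => c) Z = ((1 + p) * (1 + p ^ 2) : ℕ) * ((p : ℂ) ^ (-3 : ℤ) * c) := by
  simp only [heckeT, slash_weight_zero_const, List.map_const', List.sum_replicate,
    length_heckeTReps, nsmul_eq_mul, Rat.cast_natCast]

/-- Fails-instance: the constant function `1` is NOT a `T(2)`-eigenfunction of weight `0` with
eigenvalue `a = 0` (whatever `a₁`): at `Z = i·1₂ ∈ ℍ₂`, `(1|₀T(2))(Z) = 15/8 ≠ 0`. So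
`IsHeckeEigenAt` is not trivially true. -/
theorem not_isHeckeEigenAt_const_one (a₁ : ℂ) : ¬ IsHeckeEigenAt 0 2 (fun _ => 1) 0 a₁ := by
  rintro ⟨h, -⟩
  have h1 := h _ I_smul_one_mem_siegelUpperHalfSpace
  rw [heckeT_weight_zero_const] at h1
  norm_num at h1

/-! ## The printed degree of `T₁(p²)`, `bp2` in weight 2, the constant term of `Q_p(f,T)` -/

/-- Counting helper in `simp`-normal form: `#{x < n+1 | x ≠ 0} = n`. -/
theorem length_filter_ne_zero_range_succ (n : ℕ) :
    (List.filter (fun x => !decide (x = 0)) (List.range (n + 1))).length = n := by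
  rw [List.range_succ_eq_map]
  simp [List.filter_map, Function.comp_def]

/-- The number of printed representatives of `T₁(p²)` is `deg T₁(p²) = p(1+p)(1+p²)` for `p ≥ 1`
[BrumerEtAl2019, (4.2.14)] — companion of the tree's `length_heckeTReps` (at the junk value `p = 0`
the list has one element). -/
theorem length_heckeT1Reps {p : ℕ} (hp : p ≠ 0) :
    (heckeT1Reps p).length = p * (1 + p) * (1 + p ^ 2) := by
  obtain ⟨n, rfl⟩ := Nat.exists_eq_succ_of_ne_zero hp
  simp [heckeT1Reps, List.length_flatMap, length_filter_ne_zero_range_succ]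
  ring

/-- Instance of record: `deg T₁(4) = 2 · 3 · 5 = 30` printed representatives at `p = 2`. -/
theorem length_heckeT1Reps_two : (heckeT1Reps 2).length = 30 := by
  rw [length_heckeT1Reps two_ne_zero]; rfl

/-- `bp2` in weight `2`: `b_{p²} = p·a₁ + p⁻¹(1+p²)` — the exponent `2k-5 = -1` is an honest integer
power [BrumerEtAl2019, (4.2.16)]. -/
theorem bp2_two (p : ℕ) (a₁ : ℂ) : bp2 2 p a₁ = p * a₁ + (p : ℂ)⁻¹ * (1 + (p : ℂ) ^ 2) := by
  simp only [bp2]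
  norm_num

/-- `bp2` in weight `3`: `b_{p²} = p·a₁ + p(1+p²)` (exponent `2k-5 = 1`). -/
theorem bp2_three (p : ℕ) (a₁ : ℂ) : bp2 3 p a₁ = p * a₁ + p * (1 + (p : ℂ) ^ 2) := by
  simp only [bp2]
  norm_num

/-- The spinor Hecke polynomial has constant term `1` (`Q_p(f, 0) = 1`). -/
theorem spinorHeckePoly_eval_zero (k p : ℕ) (a b : ℂ) : (spinorHeckePoly k p a b).eval 0 = 1 := by
  simp [spinorHeckePoly]

end Summit.Langlands.Paramodular.Runbook
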